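import Summits.QuantumFields.YangMills.Theorems.UnitScaleTiltProp7SymAvgGLDefs
import HarnessLib

/-!
# Route `UnitScaleTilt`, crux K1 child «MinimiserStabilityRegPr» (stmt-QuantumFields-19200), skeleton v10 stub EX, route (α), cut (S3)(i), node (AVG-SYM) —
# **CHART-47-T³-sym: [Balaban1985Variational] PROPOSITION 3 FOR THE ROUTE'S SYMMETRIC AVERAGE** (OWNER RULING g25-№3 §3(b), DECISION 02:42:41Z OPTION A):
# the symmetric remainder **`CmapSym U₀`** = the log-chart of the complexified (0.4) descent `A ↦ log[D̄_{n,K}(e^{A}U₀)·D̄_{n,K}(U₀)⁻¹]` MINUS its linearisation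
# **`QSym U₀`** (print's (44) «Q_j(ηA) = LʲηQ_jA + C_j(LʲηA)» with the SYMMETRIC `Q`), r08's scheme `B11Prop3Model` (`Dfix`, `Inputs`) INSTANTIATED at it, the named
# row **`Chart47T3sym`** ((49), range sandwich, (55) — same shape as `Prop7ChartT3.Chart47T3` with the coarse data on the ROUTE's coarse lattice `PBond (F.P n) 0`), and
# **`chart47sym_of_inputs : Inputs (CmapSym U₀) H C₂ C₃ B₀ c₄ → (9C₂B₀ε < 1, 3ε ≤ 2c₄) → Chart47T3sym`** (r08 + `B12Lineariz267` by `exact`), the `Inputs` = the DISPLAYED rows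
# (AVG-SYM-44)∕(-72)∕(-an) at a curved background

Cell `ym3-torus` ∕ width seat `ym-ust-19200-w1` (gen 2).  YM₃ on T³ is ladder rung R3, not the Clay problem; nothing here is a claim about the crux or the gap.

THE PRINT.  [Balaban1985Variational] p. 285: «The Proposition 4 of [4] implies Q_j(ηA) = LʲηQ_jA + C_j(LʲηA), |C_j(LʲηA)| ≦ C₂(Lʲη)²|A|². (44) … We will construct the
linearizing transformation in the form A = A′ − HD(A′), (47) … C_j(LʲηA′ − LʲηHD(A′)) = D(A′) on Λ_j. (49) … We consider configurations A′, X with values in the complexified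
Lie algebra 𝔤ᶜ (51)»; p. 289 Prop. 3 (quoted in `Prop7Chart47T3Defs`); [Balaban1987RG1] p. 253: the (0.4) average and «valid universally for all averages satisfying
(0.5)–(0.7)» (the warrant for running [B7] §§B–C with the symmetric average — RULING g25-№3 §1).

DECLARED READINGS ∕ HONEST SCOPE.  (i) `QSym U₀ := fderiv ℂ (logChartSym U₀) 0` — the linear part of the log-chart, BY DEFINITION (so (44)^sym's «linear part» and (48)'s
«linearizing» refer to this operator; the identification of `QSym` with a contour-averaged covariant block average, (AVG-SYM-P12), is NOT here).  (ii) The log-chart reads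
the complexified descent `descendToGL` (D1, p599179) of `e^{A}·U₀` against that of `U₀` (both `(M₂)ˣ`-valued; on small `SU(2)` data = the route's `descendTo`,
`Prop7SymAvgGL.unitsField_toUField_descendTo_of_small`); `A` ranges over ALL of `M₂(ℂ)` bondwise (print's `𝔤ᶜ = 𝔰𝔩₂(ℂ)` ⊂ `M₂(ℂ)`; the trace part is harmless for a
hypothesis-shape and is cut out by the consumer's Hermitian-traceless clause).  (iii) `Inputs` ((44)^sym quadratic bound, `C¹` on the ball, (72)^sym derivative bound, (46)
for the abstract `H`) are HYPOTHESES — the (AVG-SYM-44∕72∕an) rows + N06 — proved nowhere in the tree at a curved background; `Chart47T3sym` is therefore proved here MODULO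
them, exactly as `B11Prop3Concrete` proves the comb version modulo (46).  (iv) No smallness of `U₀` is needed for the scheme itself (it is inside `Inputs`).  Count-neutral
toward stmt-QuantumFields-19200 (`--supports`); definitions (review lane) + theorems; nothing continuum ∕ OS ∕ mass-gap ∕ Clay.

References: T. Bałaban, CMP **102** (1985) 277–309 [Balaban1985Variational] ((44)–(51) pp.285–286, (55) p.286, (57)–(62) pp.286–287, Prop. 3 p.289); CMP **109** (1987)
249–301 [Balaban1987RG1] ((0.4)–(0.7) p.253); CMP **98** (1985) 17–51 [Balaban1985Averaging] (Props 4–5 pp.38–42).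
-/

noncomputable section

open scoped Matrix.Norms.L2Operator
open Metric Set

namespace Summit.QuantumFields.YangMills.Theorems.Prop7SymAvgGL

open NormedSpace
open Literature.MathematicalPhysics.QuantumFieldTheory.Balaban1983to89
open T3ContinuumYM3Torus
open T3SectALandauChart (bgUnits)
open B7Prop1Explicit (expUnit)
open B11Prop3Model (Dfix Inputs Dfix_spec Dfix_ball Dfix_fix)
open B12Lineariz267 (mapsTo_phi phi_psi_of_norm_lt)
open MatrixLog (mlog)

variable (F : T3Family) (n K : ℕ) (h : n ≤ K)

/-! ## §1 The symmetric remainder `CmapSym(U₀)` and its linear part `QSym(U₀)` -/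

/-- **THE LOG-CHART OF THE SYMMETRIC DESCENT AT THE BACKGROUND `U₀`**: `A ↦ log[ D̄_{n,K}(e^{A}·U₀)(c) · D̄_{n,K}(U₀)(c)⁻¹ ]` — the complexified `K − n`-fold (0.4) average
(`descendToGL`) of the perturbed field `b ↦ e^{A(b)}U₀(b)` read relative to that of `U₀`, through the logarithm series (print's `Q_j(U₀, ηA)` of (44) for the SYMMETRIC
average, complexified: `A` bondwise in `M₂(ℂ) ⊇ 𝔰𝔩₂(ℂ) = 𝔤ᶜ`). [cite: Balaban1985Variational, (44) p.285, (51) p.286; Balaban1987RG1, (0.4) p.253] -/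
def logChartSym (U₀ : GaugeField (F.P K) 0 (Matrix.specialUnitaryGroup (Fin 2) ℂ)) (A : PBond (F.P K) 0 → Matrix (Fin 2) (Fin 2) ℂ) :
    PBond (F.P n) 0 → Matrix (Fin 2) (Fin 2) ℂ :=
  fun c => mlog (((descendToGL F n K h (fun b => expUnit (A b) * bgUnits F K U₀ b) c : (Matrix (Fin 2) (Fin 2) ℂ)ˣ) : Matrix (Fin 2) (Fin 2) ℂ) *
    (((descendToGL F n K h (bgUnits F K U₀) c)⁻¹ : (Matrix (Fin 2) (Fin 2) ℂ)ˣ) : Matrix (Fin 2) (Fin 2) ℂ))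

/-- **THE SYMMETRIC LINEARISED AVERAGE `QSym(U₀)`** — the linear part of the log-chart at `A = 0` (its Fréchet derivative; print's `LʲηQ_j` of (44) for the symmetric
average, read as a DEFINITION). [cite: Balaban1985Variational, (44) p.285] -/
def QSym (U₀ : GaugeField (F.P K) 0 (Matrix.specialUnitaryGroup (Fin 2) ℂ)) :
    (PBond (F.P K) 0 → Matrix (Fin 2) (Fin 2) ℂ) →L[ℂ] (PBond (F.P n) 0 → Matrix (Fin 2) (Fin 2) ℂ) :=
  fderiv ℂ (logChartSym F n K h U₀) 0

/-- **THE SYMMETRIC REMAINDER `C^sym(U₀, A) = log-chart(A) − QSym(U₀)A`** ((44) for the symmetric average: the nonlinear part of the averaging in log coordinates —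
the `Ct` of r08's `B11Prop3Model`). [cite: Balaban1985Variational, (44) p.285, (49)–(50) p.285] -/
def CmapSym (U₀ : GaugeField (F.P K) 0 (Matrix.specialUnitaryGroup (Fin 2) ℂ)) (A : PBond (F.P K) 0 → Matrix (Fin 2) (Fin 2) ℂ) :
    PBond (F.P n) 0 → Matrix (Fin 2) (Fin 2) ℂ :=
  logChartSym F n K h U₀ A - QSym F n K h U₀ A

/-! ## §2 The row CHART-47-T³-sym -/

/-- **CHART-47-T³-sym — [Balaban1985Variational] PROPOSITION 3 FOR THE SYMMETRIC AVERAGE AT THE T³ OBJECTS** (member `F`, `n ≤ K`; background `U₀`; print's `C₂` and radius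
`ε = ε₃`; the letter `H` an abstract linear map from coarse data on the route's coarse lattice `PBond (F.P n) 0` to fine fields): with `D := B11Prop3Model.Dfix (CmapSym U₀) H C₂`
— (49)^sym «C^sym(A′ − HD(A′)) = D(A′)» on the `ε`-ball; «the range … contains (43) with ε₂ ≦ ½ε» (tree radius of `B12Lineariz267.phi_psi_of_norm_lt`); «… is contained in
the corresponding set with 2ε»; (55) «‖D(A′)‖ ≦ 4C₂‖A′‖²».  ASSERTED FOR NOTHING; proved from `Inputs` in §3.
[cite: Balaban1985Variational, Prop. 3 p.289, (47)–(49) p.285, (55) p.286, (57)–(62) pp.286–287] -/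
def Chart47T3sym (C₂ ε : ℝ) (U₀ : GaugeField (F.P K) 0 (Matrix.specialUnitaryGroup (Fin 2) ℂ))
    (H : (PBond (F.P n) 0 → Matrix (Fin 2) (Fin 2) ℂ) →ₗ[ℂ] (PBond (F.P K) 0 → Matrix (Fin 2) (Fin 2) ℂ)) : Prop :=
  (∀ A' : PBond (F.P K) 0 → Matrix (Fin 2) (Fin 2) ℂ, ‖A'‖ < ε →
      CmapSym F n K h U₀ (A' - H (Dfix (CmapSym F n K h U₀) H C₂ A')) = Dfix (CmapSym F n K h U₀) H C₂ A') ∧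
  (∀ A : PBond (F.P K) 0 → Matrix (Fin 2) (Fin 2) ℂ, ‖A‖ < ε / 2 →
      ∃ A' : PBond (F.P K) 0 → Matrix (Fin 2) (Fin 2) ℂ, ‖A'‖ < ε ∧ A' - H (Dfix (CmapSym F n K h U₀) H C₂ A') = A) ∧
  (∀ A' : PBond (F.P K) 0 → Matrix (Fin 2) (Fin 2) ℂ, ‖A'‖ < ε → ‖A' - H (Dfix (CmapSym F n K h U₀) H C₂ A')‖ < 2 * ε) ∧
  (∀ A' : PBond (F.P K) 0 → Matrix (Fin 2) (Fin 2) ℂ, ‖A'‖ < ε → ‖Dfix (CmapSym F n K h U₀) H C₂ A'‖ ≤ 4 * C₂ * ‖A'‖ ^ 2)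

/-! ## §3 CHART-47-T³-sym from the displayed `Inputs` (r08's scheme, verbatim) -/

variable {F n K h}

/-- ★ **CHART-47-T³-sym ⇐ (AVG-SYM-44∕72∕an) ∧ (46) ∧ print's smallness**: for the symmetric remainder `CmapSym U₀`, any linear `H`, constants with `B11Prop3Model.Inputs (CmapSym U₀) H
C₂ C₃ B₀ c₄` ((44)^sym on the `2c₄`-ball, `C¹` there, (72)^sym, ‖HX‖ ≤ B₀‖X‖ — DISPLAYED), `C₂, B₀ ≥ 0` and the contraction window «9C₂B₀ε₃ < 1» (p. 286), `3ε ≤ 2c₄`: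
`Chart47T3sym F n K h C₂ ε U₀ H` — r08's `Dfix_fix`∕`Dfix_spec`, and `B12Lineariz267.phi_psi_of_norm_lt`∕`mapsTo_phi` for the range sandwich.
[cite: Balaban1985Variational, Prop. 3 p.289, (49)–(55) pp.285–286, (57)–(62) pp.286–287] -/
theorem chart47sym_of_inputs {C₂ C₃ B₀ c₄ ε : ℝ} {U₀ : GaugeField (F.P K) 0 (Matrix.specialUnitaryGroup (Fin 2) ℂ)}
    {H : (PBond (F.P n) 0 → Matrix (Fin 2) (Fin 2) ℂ) →ₗ[ℂ] (PBond (F.P K) 0 → Matrix (Fin 2) (Fin 2) ℂ)}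
    (hin : Inputs (CmapSym F n K h U₀) H C₂ C₃ B₀ c₄) (hC₂ : 0 ≤ C₂) (hB₀ : 0 ≤ B₀) (hq : 9 * C₂ * B₀ * ε < 1) (hRC : 3 * ε ≤ 2 * c₄) :
    Chart47T3sym F n K h C₂ ε U₀ H := by
  have hQA := hin.quadAnalytic
  have hDfix := Dfix_fix (Ct := CmapSym F n K h U₀) (hop := H) hQA hC₂ hB₀ hin.norm_H hq hRC
  have hDball := Dfix_ball (Ct := CmapSym F n K h U₀) (hop := H) hQA hC₂ hB₀ hin.norm_H hq hRC
  refine ⟨fun A' hA' => hDfix A' hA', fun A hA => ?_, fun A' hA' => ?_, fun A' hA' => ?_⟩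
  · obtain ⟨hΨ, hΦΨ⟩ := phi_psi_of_norm_lt (Dt := Dfix (CmapSym F n K h U₀) H C₂) hQA hC₂ hB₀ hin.norm_H hq hRC hDball hDfix hA
    exact ⟨A + H (CmapSym F n K h U₀ A), hΨ, hΦΨ⟩
  · have hm := mapsTo_phi (Dt := Dfix (CmapSym F n K h U₀) H C₂) hQA hC₂ hB₀ hin.norm_H hq hRC hDball hDfix (mem_ball_zero_iff.2 hA')
    exact mem_ball_zero_iff.1 hm
  · exact (Dfix_spec (Ct := CmapSym F n K h U₀) (hop := H) hQA hC₂ hB₀ hin.norm_H hq hRC hA').1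

end Summit.QuantumFields.YangMills.Theorems.Prop7SymAvgGL

end
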